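import Summits.CriticalPhenomena.PercolationContinuityZ3.Theorems.PercNearOneGluingNoHeavyLowerTailSetPortMerge
import Summits.CriticalPhenomena.PercolationContinuityZ3.Theorems.PercNearOneGluingNoHeavyLowerTailCILRelayNeighboursHolds
import Summits.CriticalPhenomena.PercolationContinuityZ3.Theorems.PercNearOneGluingNoHeavyLowerTailCILAveragedPortTools
import Literature.Probability.LatticeModels.ProdBernoulliIndependence
import HarnessLib

/-!
# `NoHeavyLowerTail` (stmt-CriticalPhenomena-4575) — the HIERARCHICAL averaged-port inequality for a pair of relay-neighboured
# Steiner vertices, from two SINGLE-observer inequalities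

Support file (prover `prim-hp-6`, hull-port cell, observer-set / OES technique; `--supports stmt-CriticalPhenomena-4575`).
No definitions, no named facts, no sorries.

Setting (`μ_w = prodBernoulli w` on `Fin n`, relays `A`, level `j`, lightness `I_w(x) = μ_w{|π(x)| ≤ j}`): two non-relay vertices
`u₁ ≠ u₂` whose positive-weight pairs all go to relays — the ports `p 0..p (d₁−1)` of `u₁` and `q 0..q (d₂−1)` of `u₂` (so there is no
pair `u₁–u₂`); first-open-port events `A¹_i = {u₁–p i open, u₁–p m closed for m < i}`, `A²_m` likewise, `Z¹ = {every u₁–p i closed}`;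
`w ∖ u₁` = `w` with the pairs at `u₁` switched off.  Two single-observer inequalities:
* AP1 (prim-lf-3's averaged port domination, `AveragedPort.bad_le_firstOpenSum`, written as `Σ_i μ(A_i ∩ {p i light}) ≤ Σ_i μ(A_i)·I(p i)`;
  for a relay-neighboured observer `μ{1 ≤ N ≤ j} = Σ_i μ(A_i ∩ {p i light})` since on `A_i` the clusters of `o` and `p i` coincide);
* AP1⁺ (this seat's conjectured strengthening, crux evidence HP6-MEMO3-SETAP1.md §5; 0 violations in ≈ 2·10⁴ exact instances, proved for
  `d ≤ 2` by one two-point exchange): for every vertex `x`,  `Σ_i μ(A_i ∩ {p i light}) + μ(Z ∩ {x light}) ≤ Σ_i μ(A_i)·I(p i) + μ(Z)·I(x)`,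
  i.e. AP1 with the extra slack `μ(Z)·(I_{w∖o}(x) − I_w(x))` ("the observer's influence on `x`").

* `SetPort.hsap_pair` — **THEOREM (hierarchical set averaged-port inequality for a pair):** AP1⁺ for `u₁` under `w` (tested at the ports
  of `u₂`), AP1 for `u₁` under `w`, and AP1 for `u₂` under `w ∖ u₁` imply
  `Σ_i μ_w(A¹_i ∩ {p i light}) + Σ_m μ_w(Z¹ ∩ A²_m ∩ {q m light}) ≤ Σ_i μ_w(A¹_i)·I_w(p i) + Σ_m μ_w(Z¹ ∩ A²_m)·I_w(q m)`.
  Proof: conditioning on `Z¹` is deleting `u₁`'s pairs (`SetPort.real_allClosed_inter_eq`), which turns the `u₂`-terms into AP1 under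
  `w ∖ u₁` plus the reference correction `Σ_m μ(A²_m)·(I_{w∖u₁}(q m) − I_w(q m))`, and AP1⁺ for `u₁` pays for that correction because
  `Σ_m μ(A²_m) ≤ 1`.
* `SetPort.bad_pair_le_hier` — hence the c-free averaged port bound for the glued pair:
  `μ_w{1 ≤ |π({u₁,u₂})| ≤ j} ≤ Σ_i μ_w(A¹_i)·I_w(p i) + Σ_m μ_w(Z¹ ∩ A²_m)·I_w(q m)` (`≤ (1 − μ(no open pair))·max port lightness`), which is
  prim-lf-3's (APz) for two stars (LF3-APSTAR.md §1) reduced to the single-observer statement AP1⁺.  The same bookkeeping iterates over any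
  number of members (memo §5: each member's AP1⁺ slack pays for the reference corrections of all later members).
-/

noncomputable section

namespace Summit.CriticalPhenomena.PercolationContinuityZ3.Theorems

open MeasureTheory Set Literature.Probability.LatticeModels Literature.Probability.Percolation
open scoped Classical BigOperators

variable {n : ℕ}

namespace SetPort

/-! ### Conditioning on "no open pair at `u₁`" is deleting the pairs at `u₁` -/

/-- If every positive-weight pair at `u` goes to an enumerated port and no port pair is open, then (on the support event) no pair at
`u` is open at all. [folklore] -/
theorem inter_avoid_eq_self_of_allClosed (w : Sym2 (Fin n) → unitInterval) (u : Fin n) {d : ℕ} (p : Fin d → Fin n)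
    (hobs : ∀ v, w s(u, v) ≠ 0 → ∃ i, v = p i) {ω : BondConfig (Fin n)} (hω : ∀ e ∈ ω, w e ≠ 0)
    (hZ : ∀ i, s(u, p i) ∉ ω) : ω ∩ {e | u ∉ e} = ω := by
  refine Set.inter_eq_left.2 fun e he => ?_
  intro hue
  obtain ⟨v, rfl⟩ := Sym2.mem_iff_exists.1 hue
  obtain ⟨i, rfl⟩ := hobs v (hω _ he)
  exact hZ i he

/-- **Conditioning on `Z = {no open pair at u}` is deleting the pairs at `u`:** for every event `E`,
`μ_w(Z ∩ E) = μ_w(Z) · μ_{w∖u}(E)`. [folklore] -/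
theorem real_allClosed_inter_eq (w : Sym2 (Fin n) → unitInterval) (u : Fin n) {d : ℕ} (p : Fin d → Fin n)
    (hobs : ∀ v, w s(u, v) ≠ 0 → ∃ i, v = p i) (E : Set (BondConfig (Fin n))) :
    (prodBernoulli w).real ({ω : BondConfig (Fin n) | ∀ i, s(u, p i) ∉ ω} ∩ E) =
      (prodBernoulli w).real {ω : BondConfig (Fin n) | ∀ i, s(u, p i) ∉ ω} *
        (prodBernoulli fun e => if e ∈ {e : Sym2 (Fin n) | u ∉ e} then w e else 0).real E := by
  set Z : Set (BondConfig (Fin n)) := {ω | ∀ i, s(u, p i) ∉ ω} with hZ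
  set Eh : Set (BondConfig (Fin n)) := {ω | ω ∩ {e | u ∉ e} ∈ E} with hEh
  -- a.s. on `Z`, `E` and its `u`-avoiding version agree
  have h1 : (prodBernoulli w).real (Z ∩ E) = (prodBernoulli w).real (Z ∩ Eh) := by
    rw [← CutObserver.measureReal_inter_support w (Z ∩ E), ← CutObserver.measureReal_inter_support w (Z ∩ Eh)]
    congr 1
    ext ω
    simp only [mem_inter_iff, hZ, hEh, mem_setOf_eq]
    constructor
    · rintro ⟨⟨hz, hE⟩, hω⟩
      exact ⟨⟨hz, by rw [inter_avoid_eq_self_of_allClosed w u p hobs hω hz]; exact hE⟩, hω⟩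
    · rintro ⟨⟨hz, hE⟩, hω⟩
      exact ⟨⟨hz, by rw [inter_avoid_eq_self_of_allClosed w u p hobs hω hz] at hE; exact hE⟩, hω⟩
  -- independence: `Z` is determined by the port pairs, `Eh` by the pairs avoiding `u`
  set F : Finset (Sym2 (Fin n)) := Finset.univ.image fun i : Fin d => s(u, p i) with hF
  have hZdet : DeterminedBy Z (↑F : Set (Sym2 (Fin n))) := by
    rw [determinedBy_iff]
    intro ω ω' h
    have key : ∀ i, (s(u, p i) ∈ ω ↔ s(u, p i) ∈ ω') := by
      intro i
      have hmem : s(u, p i) ∈ (↑F : Set (Sym2 (Fin n))) := by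
        rw [Finset.mem_coe, hF, Finset.mem_image]; exact ⟨i, Finset.mem_univ _, rfl⟩
      have := Set.ext_iff.1 h (s(u, p i))
      simp only [mem_inter_iff, hmem, and_true] at this
      exact this
    simp only [hZ, mem_setOf_eq]
    exact forall_congr' fun i => not_congr (key i)
  have hEdet : DeterminedBy Eh (↑F : Set (Sym2 (Fin n)))ᶜ := by
    rw [determinedBy_iff]
    intro ω ω' h
    have hsub : {e : Sym2 (Fin n) | u ∉ e} ⊆ (↑F : Set (Sym2 (Fin n)))ᶜ := by
      intro e he heF
      rw [Finset.mem_coe, hF, Finset.mem_image] at heF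
      obtain ⟨i, -, rfl⟩ := heF
      exact he (Sym2.mem_mk_left _ _)
    have key : ω ∩ {e | u ∉ e} = ω' ∩ {e | u ∉ e} := by
      have e1 : ω ∩ {e | u ∉ e} = (ω ∩ (↑F : Set (Sym2 (Fin n)))ᶜ) ∩ {e | u ∉ e} := by
        rw [Set.inter_assoc, Set.inter_eq_right.2 hsub]
      have e2 : ω' ∩ {e | u ∉ e} = (ω' ∩ (↑F : Set (Sym2 (Fin n)))ᶜ) ∩ {e | u ∉ e} := by
        rw [Set.inter_assoc, Set.inter_eq_right.2 hsub]
      rw [e1, e2, h]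
    simp only [hEh, mem_setOf_eq, key]
  have h2 : (prodBernoulli w).real (Z ∩ Eh) = (prodBernoulli w).real Z * (prodBernoulli w).real Eh :=
    prodBernoulli_real_inter_of_determinedBy w F hZdet hEdet MeasurableSet.of_discrete MeasurableSet.of_discrete
  rw [h1, h2, hEh, CutObserver.measureReal_preimage_avoid]

/-! ### The hierarchical inequality for a pair -/

/-- **Hierarchical set averaged-port inequality for two relay-neighboured Steiner vertices.**  `u₁ ≠ u₂ ∉ A`, every positive pair
at `u₁` (`u₂`) goes to a port `p i ∈ A` (`q m ∈ A`).  Assume AP1 for `u₁` under `w`, AP1⁺ for `u₁` under `w` tested at every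
`q m`, and AP1 for `u₂` under `w ∖ u₁`.  Then
`Σ_i μ(A¹_i ∩ {p i light}) + Σ_m μ(Z¹ ∩ A²_m ∩ {q m light}) ≤ Σ_i μ(A¹_i)·I(p i) + Σ_m μ(Z¹ ∩ A²_m)·I(q m)` (all under `w`).
[this file; conditional on the single-observer inequalities AP1 (prim-lf-3) and AP1⁺ (crux evidence HP6-MEMO3-SETAP1.md)] -/
theorem hsap_pair (w : Sym2 (Fin n) → unitInterval) (A : Finset (Fin n)) (u₁ u₂ : Fin n) (j : ℕ) {d₁ d₂ : ℕ}
    (p : Fin d₁ → Fin n) (q : Fin d₂ → Fin n)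
    (hobs₁ : ∀ v, w s(u₁, v) ≠ 0 → ∃ i, v = p i)
    (hAP1 : ∑ i : Fin d₁, (prodBernoulli w).real ({ω : BondConfig (Fin n) | s(u₁, p i) ∈ ω ∧ ∀ m, m < i → s(u₁, p m) ∉ ω} ∩
          {ω | (A.filter fun z => ω ∈ openConn (p i) z).card ≤ j}) ≤
      ∑ i : Fin d₁, (prodBernoulli w).real {ω : BondConfig (Fin n) | s(u₁, p i) ∈ ω ∧ ∀ m, m < i → s(u₁, p m) ∉ ω} *
        (prodBernoulli w).real {ω : BondConfig (Fin n) | (A.filter fun z => ω ∈ openConn (p i) z).card ≤ j})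
    (hAP1plus : ∀ m₀ : Fin d₂,
      ∑ i : Fin d₁, (prodBernoulli w).real ({ω : BondConfig (Fin n) | s(u₁, p i) ∈ ω ∧ ∀ m, m < i → s(u₁, p m) ∉ ω} ∩
          {ω | (A.filter fun z => ω ∈ openConn (p i) z).card ≤ j}) +
        (prodBernoulli w).real ({ω : BondConfig (Fin n) | ∀ i, s(u₁, p i) ∉ ω} ∩
          {ω | (A.filter fun z => ω ∈ openConn (q m₀) z).card ≤ j}) ≤
      ∑ i : Fin d₁, (prodBernoulli w).real {ω : BondConfig (Fin n) | s(u₁, p i) ∈ ω ∧ ∀ m, m < i → s(u₁, p m) ∉ ω} *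
          (prodBernoulli w).real {ω : BondConfig (Fin n) | (A.filter fun z => ω ∈ openConn (p i) z).card ≤ j} +
        (prodBernoulli w).real {ω : BondConfig (Fin n) | ∀ i, s(u₁, p i) ∉ ω} *
          (prodBernoulli w).real {ω : BondConfig (Fin n) | (A.filter fun z => ω ∈ openConn (q m₀) z).card ≤ j})
    (hAP1two : ∑ m : Fin d₂, (prodBernoulli fun e => if e ∈ {e : Sym2 (Fin n) | u₁ ∉ e} then w e else 0).real
          ({ω : BondConfig (Fin n) | s(u₂, q m) ∈ ω ∧ ∀ m', m' < m → s(u₂, q m') ∉ ω} ∩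
            {ω | (A.filter fun z => ω ∈ openConn (q m) z).card ≤ j}) ≤
      ∑ m : Fin d₂, (prodBernoulli fun e => if e ∈ {e : Sym2 (Fin n) | u₁ ∉ e} then w e else 0).real
            {ω : BondConfig (Fin n) | s(u₂, q m) ∈ ω ∧ ∀ m', m' < m → s(u₂, q m') ∉ ω} *
          (prodBernoulli fun e => if e ∈ {e : Sym2 (Fin n) | u₁ ∉ e} then w e else 0).real
            {ω : BondConfig (Fin n) | (A.filter fun z => ω ∈ openConn (q m) z).card ≤ j}) :
    ∑ i : Fin d₁, (prodBernoulli w).real ({ω : BondConfig (Fin n) | s(u₁, p i) ∈ ω ∧ ∀ m, m < i → s(u₁, p m) ∉ ω} ∩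
        {ω | (A.filter fun z => ω ∈ openConn (p i) z).card ≤ j}) +
      ∑ m : Fin d₂, (prodBernoulli w).real ({ω : BondConfig (Fin n) | ∀ i, s(u₁, p i) ∉ ω} ∩
        ({ω : BondConfig (Fin n) | s(u₂, q m) ∈ ω ∧ ∀ m', m' < m → s(u₂, q m') ∉ ω} ∩
          {ω | (A.filter fun z => ω ∈ openConn (q m) z).card ≤ j})) ≤
    ∑ i : Fin d₁, (prodBernoulli w).real {ω : BondConfig (Fin n) | s(u₁, p i) ∈ ω ∧ ∀ m, m < i → s(u₁, p m) ∉ ω} *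
        (prodBernoulli w).real {ω : BondConfig (Fin n) | (A.filter fun z => ω ∈ openConn (p i) z).card ≤ j} +
      ∑ m : Fin d₂, (prodBernoulli w).real ({ω : BondConfig (Fin n) | ∀ i, s(u₁, p i) ∉ ω} ∩
          {ω : BondConfig (Fin n) | s(u₂, q m) ∈ ω ∧ ∀ m', m' < m → s(u₂, q m') ∉ ω}) *
        (prodBernoulli w).real {ω : BondConfig (Fin n) | (A.filter fun z => ω ∈ openConn (q m) z).card ≤ j} := by
  set μ := prodBernoulli w with hμ
  set μ₀ := prodBernoulli (fun e => if e ∈ {e : Sym2 (Fin n) | u₁ ∉ e} then w e else 0) with hμ₀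
  set Z : Set (BondConfig (Fin n)) := {ω | ∀ i, s(u₁, p i) ∉ ω} with hZ
  set A2 : Fin d₂ → Set (BondConfig (Fin n)) := fun m =>
    {ω | s(u₂, q m) ∈ ω ∧ ∀ m', m' < m → s(u₂, q m') ∉ ω} with hA2
  set L : Fin n → Set (BondConfig (Fin n)) := fun x => {ω | (A.filter fun z => ω ∈ openConn x z).card ≤ j} with hL
  set a : ℝ := ∑ i : Fin d₁, μ.real ({ω : BondConfig (Fin n) | s(u₁, p i) ∈ ω ∧ ∀ m, m < i → s(u₁, p m) ∉ ω} ∩ L (p i)) -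
    ∑ i : Fin d₁, μ.real {ω : BondConfig (Fin n) | s(u₁, p i) ∈ ω ∧ ∀ m, m < i → s(u₁, p m) ∉ ω} * μ.real (L (p i)) with ha
  have ha0 : a ≤ 0 := by rw [ha]; linarith [hAP1]
  -- conditioning on `Z`
  have cZ : ∀ E : Set (BondConfig (Fin n)), μ.real (Z ∩ E) = μ.real Z * μ₀.real E :=
    fun E => real_allClosed_inter_eq w u₁ p hobs₁ E
  -- AP1⁺ rewritten: `a ≤ μ(Z) · (I_w(q m) − I_{w∖u₁}(q m))`
  have hplus : ∀ m : Fin d₂, a ≤ μ.real Z * (μ.real (L (q m)) - μ₀.real (L (q m))) := by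
    intro m
    have h := hAP1plus m
    rw [cZ (L (q m))] at h
    rw [ha]; linarith
  -- sums abbreviated
  set s : ℝ := ∑ m : Fin d₂, μ₀.real (A2 m) with hs
  set X : ℝ := ∑ m : Fin d₂, μ₀.real (A2 m ∩ L (q m)) with hX
  set Y : ℝ := ∑ m : Fin d₂, μ₀.real (A2 m) * μ₀.real (L (q m)) with hY
  set V : ℝ := ∑ m : Fin d₂, μ₀.real (A2 m) * μ.real (L (q m)) with hV
  have hs1 : s ≤ 1 := by
    have := AveragedPort.sum_real_firstOpen_add_allClosed
      (fun e => if e ∈ {e : Sym2 (Fin n) | u₁ ∉ e} then w e else 0) u₂ q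
    rw [hs]
    linarith [(measureReal_nonneg : 0 ≤ μ₀.real {ω : BondConfig (Fin n) | ∀ m : Fin d₂, s(u₂, q m) ∉ ω})]
  have hXY : X ≤ Y := by rw [hX, hY]; exact hAP1two
  have hZ0 : 0 ≤ μ.real Z := measureReal_nonneg
  -- the two `m`-sums of the goal, conditioned
  have e1 : ∑ m : Fin d₂, μ.real (Z ∩ (A2 m ∩ L (q m))) = μ.real Z * X := by
    rw [hX, Finset.mul_sum]
    exact Finset.sum_congr rfl fun m _ => cZ _
  have e2 : ∑ m : Fin d₂, μ.real (Z ∩ A2 m) * μ.real (L (q m)) = μ.real Z * V := by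
    rw [hV, Finset.mul_sum]
    refine Finset.sum_congr rfl fun m _ => ?_
    rw [cZ (A2 m)]; ring
  -- AP1⁺ pays for the reference correction: `s·a ≤ μ(Z)·(V − Y)`
  have G1 : s * a ≤ μ.real Z * (V - Y) := by
    have hsum : ∑ m : Fin d₂, μ₀.real (A2 m) * a ≤
        ∑ m : Fin d₂, μ₀.real (A2 m) * (μ.real Z * (μ.real (L (q m)) - μ₀.real (L (q m)))) :=
      Finset.sum_le_sum fun m _ => mul_le_mul_of_nonneg_left (hplus m) measureReal_nonneg
    have l1 : ∑ m : Fin d₂, μ₀.real (A2 m) * a = s * a := by rw [hs, Finset.sum_mul]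
    have l2 : ∑ m : Fin d₂, μ₀.real (A2 m) * (μ.real Z * (μ.real (L (q m)) - μ₀.real (L (q m)))) =
        μ.real Z * (V - Y) := by
      rw [hV, hY, ← Finset.sum_sub_distrib, Finset.mul_sum]
      exact Finset.sum_congr rfl fun m _ => by ring
    rw [l1, l2] at hsum; exact hsum
  have G2 : μ.real Z * X ≤ μ.real Z * Y := mul_le_mul_of_nonneg_left hXY hZ0
  have G3 : a * (1 - s) ≤ 0 := mul_nonpos_of_nonpos_of_nonneg ha0 (by linarith)
  -- assemble
  have goal : a + (μ.real Z * X - μ.real Z * V) ≤ 0 := by nlinarith [G1, G2, G3]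
  rw [e1, e2]
  rw [ha] at goal
  linarith

/-! ### The c-free averaged port bound for the glued pair -/

/-- **(APz) for a glued pair, from AP1 / AP1⁺.**  With the hypotheses of `hsap_pair` and `u₁, u₂ ∉ A`, ports in `A`:
`μ{1 ≤ |π({u₁,u₂})| ≤ j} ≤ Σ_i μ(A¹_i)·I(p i) + Σ_m μ(Z¹ ∩ A²_m)·I(q m)`  (`π` of the SET `{u₁,u₂}`, members not glued; this is
`bad` of the contracted pair).  [this file; conditional on AP1, AP1⁺] -/
theorem bad_pair_le_hier (w : Sym2 (Fin n) → unitInterval) (A : Finset (Fin n)) (u₁ u₂ : Fin n) (j : ℕ) {d₁ d₂ : ℕ}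
    (p : Fin d₁ → Fin n) (q : Fin d₂ → Fin n) (hu₁A : u₁ ∉ A) (hu₂A : u₂ ∉ A)
    (hpA : ∀ i, p i ∈ A) (hqA : ∀ m, q m ∈ A)
    (hobs₁ : ∀ v, w s(u₁, v) ≠ 0 → ∃ i, v = p i) (hobs₂ : ∀ v, w s(u₂, v) ≠ 0 → ∃ m, v = q m)
    (hAP1 : ∑ i : Fin d₁, (prodBernoulli w).real ({ω : BondConfig (Fin n) | s(u₁, p i) ∈ ω ∧ ∀ m, m < i → s(u₁, p m) ∉ ω} ∩
          {ω | (A.filter fun z => ω ∈ openConn (p i) z).card ≤ j}) ≤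
      ∑ i : Fin d₁, (prodBernoulli w).real {ω : BondConfig (Fin n) | s(u₁, p i) ∈ ω ∧ ∀ m, m < i → s(u₁, p m) ∉ ω} *
        (prodBernoulli w).real {ω : BondConfig (Fin n) | (A.filter fun z => ω ∈ openConn (p i) z).card ≤ j})
    (hAP1plus : ∀ m₀ : Fin d₂,
      ∑ i : Fin d₁, (prodBernoulli w).real ({ω : BondConfig (Fin n) | s(u₁, p i) ∈ ω ∧ ∀ m, m < i → s(u₁, p m) ∉ ω} ∩
          {ω | (A.filter fun z => ω ∈ openConn (p i) z).card ≤ j}) +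
        (prodBernoulli w).real ({ω : BondConfig (Fin n) | ∀ i, s(u₁, p i) ∉ ω} ∩
          {ω | (A.filter fun z => ω ∈ openConn (q m₀) z).card ≤ j}) ≤
      ∑ i : Fin d₁, (prodBernoulli w).real {ω : BondConfig (Fin n) | s(u₁, p i) ∈ ω ∧ ∀ m, m < i → s(u₁, p m) ∉ ω} *
          (prodBernoulli w).real {ω : BondConfig (Fin n) | (A.filter fun z => ω ∈ openConn (p i) z).card ≤ j} +
        (prodBernoulli w).real {ω : BondConfig (Fin n) | ∀ i, s(u₁, p i) ∉ ω} *
          (prodBernoulli w).real {ω : BondConfig (Fin n) | (A.filter fun z => ω ∈ openConn (q m₀) z).card ≤ j})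
    (hAP1two : ∑ m : Fin d₂, (prodBernoulli fun e => if e ∈ {e : Sym2 (Fin n) | u₁ ∉ e} then w e else 0).real
          ({ω : BondConfig (Fin n) | s(u₂, q m) ∈ ω ∧ ∀ m', m' < m → s(u₂, q m') ∉ ω} ∩
            {ω | (A.filter fun z => ω ∈ openConn (q m) z).card ≤ j}) ≤
      ∑ m : Fin d₂, (prodBernoulli fun e => if e ∈ {e : Sym2 (Fin n) | u₁ ∉ e} then w e else 0).real
            {ω : BondConfig (Fin n) | s(u₂, q m) ∈ ω ∧ ∀ m', m' < m → s(u₂, q m') ∉ ω} *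
          (prodBernoulli fun e => if e ∈ {e : Sym2 (Fin n) | u₁ ∉ e} then w e else 0).real
            {ω : BondConfig (Fin n) | (A.filter fun z => ω ∈ openConn (q m) z).card ≤ j}) :
    (prodBernoulli w).real {ω : BondConfig (Fin n) |
        1 ≤ (A.filter fun z => ∃ x ∈ ({u₁, u₂} : Finset (Fin n)), ω ∈ openConn x z).card ∧
        (A.filter fun z => ∃ x ∈ ({u₁, u₂} : Finset (Fin n)), ω ∈ openConn x z).card ≤ j} ≤
    ∑ i : Fin d₁, (prodBernoulli w).real {ω : BondConfig (Fin n) | s(u₁, p i) ∈ ω ∧ ∀ m, m < i → s(u₁, p m) ∉ ω} *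
        (prodBernoulli w).real {ω : BondConfig (Fin n) | (A.filter fun z => ω ∈ openConn (p i) z).card ≤ j} +
      ∑ m : Fin d₂, (prodBernoulli w).real ({ω : BondConfig (Fin n) | ∀ i, s(u₁, p i) ∉ ω} ∩
          {ω : BondConfig (Fin n) | s(u₂, q m) ∈ ω ∧ ∀ m', m' < m → s(u₂, q m') ∉ ω}) *
        (prodBernoulli w).real {ω : BondConfig (Fin n) | (A.filter fun z => ω ∈ openConn (q m) z).card ≤ j} := by
  refine le_trans ?_ (hsap_pair w A u₁ u₂ j p q hobs₁ hAP1 hAP1plus hAP1two)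
  set U : Finset (Fin n) := {u₁, u₂} with hU
  set bad : Set (BondConfig (Fin n)) := {ω : BondConfig (Fin n) |
    1 ≤ (A.filter fun z => ∃ x ∈ U, ω ∈ openConn x z).card ∧
    (A.filter fun z => ∃ x ∈ U, ω ∈ openConn x z).card ≤ j} with hbad
  set G1 : Fin d₁ → Set (BondConfig (Fin n)) := fun i =>
    {ω : BondConfig (Fin n) | s(u₁, p i) ∈ ω ∧ ∀ m, m < i → s(u₁, p m) ∉ ω} ∩
      {ω | (A.filter fun z => ω ∈ openConn (p i) z).card ≤ j} with hG1
  set G2 : Fin d₂ → Set (BondConfig (Fin n)) := fun m =>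
    {ω : BondConfig (Fin n) | ∀ i, s(u₁, p i) ∉ ω} ∩
      ({ω : BondConfig (Fin n) | s(u₂, q m) ∈ ω ∧ ∀ m', m' < m → s(u₂, q m') ∉ ω} ∩
        {ω | (A.filter fun z => ω ∈ openConn (q m) z).card ≤ j}) with hG2
  have hUA : Disjoint U A := by
    rw [hU, Finset.disjoint_left]
    intro x hx
    rcases Finset.mem_insert.1 hx with rfl | hx
    · exact hu₁A
    · rw [Finset.mem_singleton] at hx; rw [hx]; exact hu₂A
  -- lightness of a port attached to a member is implied by lightness of the set
  have hsub : ∀ (ω : BondConfig (Fin n)) (x y : Fin n), x ∈ U → (openGraph ω).Reachable x y →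
      (A.filter fun z => ∃ x ∈ U, ω ∈ openConn x z).card ≤ j →
      (A.filter fun z => ω ∈ openConn y z).card ≤ j := by
    intro ω x y hx hxy hj
    refine le_trans (Finset.card_le_card fun z hz => ?_) hj
    rw [Finset.mem_filter] at hz ⊢
    exact ⟨hz.1, x, hx, hxy.trans hz.2⟩
  rw [← CutObserver.measureReal_inter_support w bad]
  calc (prodBernoulli w).real (bad ∩ {ω | ∀ e ∈ ω, w e ≠ 0})
      ≤ (prodBernoulli w).real ((⋃ i, G1 i) ∪ ⋃ m, G2 m) := by
        refine measureReal_mono (fun ω hω => ?_) (measure_ne_top _ _)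
        obtain ⟨⟨h1, hj⟩, hω⟩ := hω
        by_cases hopen : ∃ i, s(u₁, p i) ∈ ω
        · -- the first open pair of `u₁`
          left
          set S := Finset.univ.filter (fun i : Fin d₁ => s(u₁, p i) ∈ ω) with hS
          obtain ⟨i₀, hi₀⟩ := hopen
          have hSne : S.Nonempty := ⟨i₀, Finset.mem_filter.2 ⟨Finset.mem_univ _, hi₀⟩⟩
          have hl : s(u₁, p (S.min' hSne)) ∈ ω := (Finset.mem_filter.1 (Finset.min'_mem S hSne)).2
          refine mem_iUnion.2 ⟨S.min' hSne, ⟨hl, fun m hm hm' => ?_⟩, ?_⟩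
          · exact absurd hm (not_lt.2 (Finset.min'_le S m (Finset.mem_filter.2 ⟨Finset.mem_univ _, hm'⟩)))
          · have hne : u₁ ≠ p (S.min' hSne) := fun h => hu₁A (h ▸ hpA _)
            exact hsub ω u₁ _ (by simp [hU]) (SimpleGraph.Adj.reachable ((openGraph_adj ω _ _).2 ⟨hl, hne⟩)) hj
        · -- no open pair at `u₁`: the relays reached are reached from `u₂`
          right
          have hZ : ∀ i, s(u₁, p i) ∉ ω := fun i hi => hopen ⟨i, hi⟩
          obtain ⟨z, hz⟩ := Finset.card_pos.1 (by omega : 0 < (A.filter fun z => ∃ x ∈ U, ω ∈ openConn x z).card)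
          rw [Finset.mem_filter] at hz
          obtain ⟨hzA, x, hx, hxz⟩ := hz
          -- `x = u₂`: `u₁` has no open pair at all
          have hx2 : x = u₂ := by
            rcases Finset.mem_insert.1 hx with rfl | hx'
            · exfalso
              have hzx : z ≠ x := fun h => hu₁A (h ▸ hzA)
              obtain ⟨wk⟩ := (hxz : (openGraph ω).Reachable x z)
              cases wk with
              | nil => exact hzx rfl
              | @cons _ v _ hadj _ =>
                rw [openGraph_adj] at hadj
                have := inter_avoid_eq_self_of_allClosed w x p hobs₁ hω hZ
                have hmem : s(x, v) ∈ ω ∩ {e | x ∉ e} := by rw [this]; exact hadj.1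
                exact hmem.2 (Sym2.mem_mk_left _ _)
            · exact Finset.mem_singleton.1 hx'
          rw [hx2] at hxz
          have hzU : z ∉ ({u₂} : Finset (Fin n)) := by
            rw [Finset.mem_singleton]; intro h; exact hu₂A (h ▸ hzA)
          obtain ⟨x', hx', v, hv, hxv, -⟩ :=
            exists_exit_of_reachable ({u₂} : Finset (Fin n)) (Finset.mem_singleton_self _) hzU hxz
          rw [Finset.mem_singleton] at hx'
          rw [hx'] at hxv
          obtain ⟨m₀, rfl⟩ := hobs₂ v (hω _ hxv)
          set S := Finset.univ.filter (fun m : Fin d₂ => s(u₂, q m) ∈ ω) with hS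
          have hSne : S.Nonempty := ⟨m₀, Finset.mem_filter.2 ⟨Finset.mem_univ _, hxv⟩⟩
          have hl : s(u₂, q (S.min' hSne)) ∈ ω := (Finset.mem_filter.1 (Finset.min'_mem S hSne)).2
          refine mem_iUnion.2 ⟨S.min' hSne, hZ, ⟨hl, fun m hm hm' => ?_⟩, ?_⟩
          · exact absurd hm (not_lt.2 (Finset.min'_le S m (Finset.mem_filter.2 ⟨Finset.mem_univ _, hm'⟩)))
          · have hne : u₂ ≠ q (S.min' hSne) := fun h => hu₂A (h ▸ hqA _)
            exact hsub ω u₂ _ (by simp [hU]) (SimpleGraph.Adj.reachable ((openGraph_adj ω _ _).2 ⟨hl, hne⟩)) hj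
    _ ≤ (prodBernoulli w).real (⋃ i, G1 i) + (prodBernoulli w).real (⋃ m, G2 m) := measureReal_union_le _ _
    _ ≤ ∑ i : Fin d₁, (prodBernoulli w).real (G1 i) + ∑ m : Fin d₂, (prodBernoulli w).real (G2 m) :=
        add_le_add (measureReal_iUnion_fintype_le _) (measureReal_iUnion_fintype_le _)

end SetPort

end Summit.CriticalPhenomena.PercolationContinuityZ3.Theorems

end
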